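import Mathlib
import HarnessLib

/-!
# The linearised phonon Boltzmann (pair-collision) operator of the pinned anharmonic chain

Kinetic-theory objects for the infinite pinned chain `pinnedChain ω₂ lam β γ` of
`Literature/MathematicalPhysics/KineticTheory/FouriersLaw.lean` (`U(q) = ω₂q²/2 + lam q⁴/4`,
`V(r) = r²/2 + βr⁴/4`, unit masses) at unit temperature, following Aoki–Lukkarinen–Spohn 2006
(ALS; on-site quartic vertex) and Lukkarinen–Spohn 2008 (LS2008) / Lukkarinen 2016 (bond quartic
vertex, `ε`-regularised definition of the collision operator):

* the band `ω(k) = √(ω₂ + 2(1 - cos k))`, `k ∈ 𝕋 = ℝ/2πℤ` (= ALS's `ω₀(1 - 2δ cos 2πk)^{1/2}`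
  with `ω₀² = ω₂ + 2`, `δ = 1/(ω₂ + 2)`), its group velocity `ω'(k) = sin k / ω(k)`;
* the combined quartic vertex of the pair process `(k₁, k₂) → (k₃, k₄)`, `k₄ = k₁ + k₂ - k₃`:
  `v = lam + β·B`, `B(k₁,k₂,k₃) = Re[(e^{ik₁}-1)(e^{ik₂}-1)(e^{-ik₃}-1)(e^{-ik₄}-1)]
  = 16 sin(k₁/2) sin(k₂/2) sin(k₃/2) sin(k₄/2)` (proved: `bondVertex_coe`);
* the resonance function `Ω = ω₁ + ω₂ - ω₃ - ω₄` and the `ε`-regularised collision weight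
  `W_ε = (9π/16) v² (ω₁ω₂ω₃ω₄)⁻² δ_ε(Ω)`, `δ_ε(s) = ε/(π(s² + ε²))` (LS2008 §3 eq. (3.1));
* the regularised linearised collision operator `L_ε = T_ε† T_ε` on the real Hilbert space
  `H = L²(𝕋, dk)` (`dk` = Haar probability measure = ALS's `∫_{-1/2}^{1/2} dk`), where
  `T_ε f = √W_ε · (f₁ + f₂ - f₃ - f₄) ∈ L²(𝕋³)`; it is bounded, self-adjoint and non-negative
  (proved) and `⟪f, L_ε f⟫ = ∫_{𝕋³} W_ε (f₁ + f₂ - f₃ - f₄)²` (proved,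
  `inner_collisionOpReg_eq_integral`) — ALS (4.1) = LS2008 (3.2) with `δ ↦ δ_ε`;
  the modified operator `L̃_ε = ω L_ε ω` (LS2008 (1.17)) and the current weight `ṽ = ω'`;
* the `ε → 0⁺` limits (junk value if the limit does not exist, as `limUnder`): the collision
  quadratic form `pinnedChainCollisionForm ω₂ lam β f = lim_ε ⟪f, L_ε f⟫` (ALS (4.1)/(4.11);
  LS2008 Prop. 3.1 is the FPU analogue of the existence statement), the kinetic profile
  `pinnedChainKineticProfile ω₂ lam β τ = lim_ε ⟪ṽ, exp(-τ L̃_ε) ṽ⟫` (ALS (3.21):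
  `K(τ) = ⟨ṽ, e^{-τL̃} ṽ⟩`; kinetic theory predicts `K(τ) = lim_{T→0⁺} T⁻² C_T(τ T⁻²)` for the
  current correlation of `pinnedChain`), and the kinetic constant
  `pinnedChainKineticConstant = ∫₀^∞ K` (ALS (3.22)–(3.23): `= ⟨ṽ, L̃⁻¹ṽ⟩ = lim T²κ_GK(T)`);
* collisional invariants (Spohn 2006, Definition; LS2008 Def. 2.1) `IsCollisionalInvariant ω₂ ψ`
  and the OPEN classification statement `KerCollisionEqSpan ω₂` ("`ker L = span{1, ω}`",
  ALS §4 after (4.10): "We expect that there are no further solutions, but no proof is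
  available"; proved only for `d ≥ 2`, Spohn 2006, and for the FPU band, LS2008 Thm 2.2);
* PROVED: only pair collisions are resonant on the pinned band — strict subadditivity
  `ω(a + b) < ω(a) + ω(b)` for `ω₂ > 0` (`dispersionR_add_lt`), hence
  `ω(k₁ + k₂ + k₃) < ω(k₁) + ω(k₂) + ω(k₃)` (`threeOne_nonresonant`): the `3 ↔ 1` and `4 ↔ 0`
  energy constraints have no solutions, which is why the kinetic operator is the
  number-conserving one (ALS §3 after (3.15), citing Spohn, JSP 124 (2006) App. 18.1;
  Lukkarinen 2016 §2.2.1–2.2.2).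

## Normalisation (why these constants give `lim_{T→0⁺} T²κ_GK(T)` for `pinnedChain ω₂ lam β γ`)

ALS (3.17)–(3.20) at inverse temperature `β_ALS = 1` with the on-site vertex `λ` replaced by the
combined vertex `v` (Lukkarinen 2016 §1.3, §2.1: the pair-collision rate is `36π|Φ₄|²` with
`Φ₄ = α̂₄ ∏(2ω_ℓ)^{-1/2}`, `α̂₄ = lam + β·2Re∏_{ℓ=1}^{3}(1 - e^{-ik_ℓ})`, which on the
constraint surface is `v` above; for `β = 0` this is ALS (3.17), for `lam = 0` Lukkarinen's FPU
rate `9π(2λ₄)²ω̄⁻⁸∏ω_ℓ`): `Lf(k₁) = (9π/4)∫ dk₂dk₃ v²(ω₁ω₂ω₃ω₄)⁻² δ(Ω)(f₁ + f₂ - f₃ - f₄)`,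
whose quadratic form is ALS (4.1) with the extra `v²`. The harmonic energy current is
`J = ∫ j(k) a*(k)a(k) dk`, `j = (2π)⁻¹ ωω'` (ALS (3.9); for `pinnedChain`, `δω₀² = 1`), so by
ALS (3.10)–(3.13), (3.21) the kinetic limit of the unit-temperature current correlation at
coupling `ε·v` is `lim_{ε→0} C(ε⁻²τ) = ⟨j, V e^{-τ V⁻¹LV⁻¹} V j⟩`, `V = ω⁻¹`, i.e.
`K(τ) = ⟨ṽ, e^{-τL̃}ṽ⟩` with `L̃ = ωLω`, `ṽ = j/ω = dω/dk` in the angle variable with the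
probability measure. By the proved amplitude-scaling conjugacy `κ_{lam,β}(T) = κ_{lamT,βT}(1)`
(`Literature/Barriers/AtomisticToContinuum/LowTemperatureWeakAnharmonicity.lean`) one has
`C_T(t) = T²C̃₁(t)` with `C̃₁` at couplings `(lamT, βT)`, so `T⁻²C_T(τT⁻²) → K(τ)` and
`T²κ_GK(T) = ∫₀^∞ C̃₁ → ∫₀^∞ K = ⟨ṽ, L̃⁻¹ṽ⟩` — the `pinnedChain` analogue of ALS (3.22)–(3.23).
These identifications are the kinetic CONJECTURE (ALS: "even the claim (3.23) is tentative");
nothing in this file asserts them.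

## Design notes

* Why `ε`-regularisation and not the resolved form ALS (4.11): on the pinned band the Jacobian
  `|ω'(k₂) - ω'(k₄)|⁻¹` of (4.11) is singular where the non-perturbative branch `k₂ = h(k₁;k₃)`
  crosses the exchange branch `k₁ = k₃` (there `k₄ = k₂`, so `∂₂Ω = 0`; the crossing is at
  `h(k₃;k₃) =` the other momentum with the group velocity of `k₃`, which exists because
  `ω' = sin/ω` is not injective on `(0, π)` — unlike the FPU band). The form (4.11) is finite on
  Lipschitz `f` (the square vanishes at the crossing) but its "loss part" diverges
  logarithmically, so `L` need not be bounded on `L²`; we therefore follow LS2008 §3 and DEFINE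
  everything through the bounded operators `L_ε` and `ε → 0⁺` limits, never through `h`
  (whose existence/uniqueness, ALS (4.5)–(4.6), is then not needed). If `L̃_ε → L̃` in the
  strong resolvent sense the profile defined here is `⟨ṽ, e^{-τL̃}ṽ⟩`.
* `L_ε` is built as `T_ε†T_ε` so that self-adjointness and positivity are structural; the
  multiplication operator by a bounded weight is Mathlib's Hölder action of `L^∞` on `L²`
  (`ContinuousLinearMap.holderL`), with junk value `0` when the weight is not essentially
  bounded (only for `ω₂ ≤ 0` or `ε ≤ 0`, see `isBddAE_sqrt_collisionWeight`).
* Real scalars (`Lp ℝ 2`): the physical `f` are real. Functions `ℝ → ℝ` enter through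
  `periodize = AddCircle.liftIoc (2π) (-π)` and `toL2` (junk `0` off `L²`).
* Collisional invariants are stated on `ℝ³` (with `k₄` eliminated) almost everywhere for the
  two-dimensional Hausdorff measure on the resonant set, which is LS2008's "Lebesgue measure on
  any two-dimensional submanifold of the solution set" and Spohn's "almost every `(k₁,…,k₄)` under
  the constraint"; continuous pointwise invariants are invariants (`isCollisionalInvariant_of_forall`).
* NOT here: the Boltzmann equation itself, existence of the `ε → 0⁺` limits, boundedness or
  spectral properties of the limit, the kinetic conjecture linking `K` to `pinnedChain`.
-/

noncomputable section

open MeasureTheory Filter Set Function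
open scoped Topology InnerProductSpace ENNReal NNReal

namespace Literature.MathematicalPhysics.KineticTheory.HeatConduction

/-! ### The pinned band on `ℝ` (angle variable, period `2π`) -/

/-- The dispersion relation of the harmonic part of `pinnedChain ω₂ lam β γ` as a `2π`-periodic
function of the angle `k`: `ω(k) = √(ω₂ + 2(1 - cos k))` (`= ω₀(1 - 2δ cos k)^{1/2}`,
`ω₀² = ω₂ + 2`, `δω₀² = 1`). [cite: AokiLukkarinenSpohn2006, §3 eq. (3.4)] -/
def dispersionR (ω₂ : ℝ) (k : ℝ) : ℝ :=
  Real.sqrt (ω₂ + 2 * (1 - Real.cos k))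

/-- The current weight `ṽ(k) = ω'(k) = sin k / ω(k)` (group velocity; `ṽ = V j` with
`j = (2π)⁻¹ωω'` the harmonic energy-current density and `V = ω⁻¹` the equilibrium weight at unit
temperature). [cite: AokiLukkarinenSpohn2006, §3 eqs. (3.9), (3.21)] -/
def pinnedChainCurrentWeight (ω₂ : ℝ) (k : ℝ) : ℝ :=
  Real.sin k / dispersionR ω₂ k

/-- `ω` is `2π`-periodic. [folklore] -/
theorem dispersionR_periodic (ω₂ : ℝ) : Periodic (dispersionR ω₂) (2 * Real.pi) := fun k => by
  simp [dispersionR]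

/-- `ṽ` is `2π`-periodic. [folklore] -/
theorem pinnedChainCurrentWeight_periodic (ω₂ : ℝ) :
    Periodic (pinnedChainCurrentWeight ω₂) (2 * Real.pi) := fun k => by
  simp [pinnedChainCurrentWeight, (dispersionR_periodic ω₂) k]

/-- `ω` is even. [folklore] -/
theorem dispersionR_neg (ω₂ k : ℝ) : dispersionR ω₂ (-k) = dispersionR ω₂ k := by
  simp [dispersionR]

/-- `ṽ = ω'` is odd. [folklore] -/
theorem pinnedChainCurrentWeight_neg (ω₂ k : ℝ) :
    pinnedChainCurrentWeight ω₂ (-k) = -pinnedChainCurrentWeight ω₂ k := by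
  simp [pinnedChainCurrentWeight, dispersionR_neg, neg_div]

/-- `ω ≥ 0`. [folklore] -/
theorem dispersionR_nonneg (ω₂ k : ℝ) : 0 ≤ dispersionR ω₂ k := Real.sqrt_nonneg _

/-- `ω(k)² = ω₂ + 4 sin²(k/2)` for `ω₂ ≥ 0`. [folklore] -/
theorem dispersionR_sq (ω₂ : ℝ) (hω : 0 ≤ ω₂) (k : ℝ) :
    dispersionR ω₂ k ^ 2 = ω₂ + 4 * Real.sin (k / 2) ^ 2 := by
  have hc : Real.cos k = 1 - 2 * Real.sin (k / 2) ^ 2 := by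
    have h2 : Real.cos k = Real.cos (2 * (k / 2)) := by ring_nf
    rw [h2, Real.cos_two_mul, Real.cos_sq']
    ring
  unfold dispersionR
  rw [Real.sq_sqrt (by nlinarith [Real.cos_le_one k]), hc]
  ring

/-- `√ω₂ ≤ ω(k)`: the band is gapped for `ω₂ > 0`. [folklore] -/
theorem sqrt_le_dispersionR (ω₂ k : ℝ) : Real.sqrt ω₂ ≤ dispersionR ω₂ k :=
  Real.sqrt_le_sqrt (by nlinarith [Real.cos_le_one k])

/-- `ω > 0` for `ω₂ > 0`. [folklore] -/
theorem dispersionR_pos {ω₂ : ℝ} (hω : 0 < ω₂) (k : ℝ) : 0 < dispersionR ω₂ k :=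
  lt_of_lt_of_le (Real.sqrt_pos.2 hω) (sqrt_le_dispersionR ω₂ k)

/-- `2|sin(k/2)| ≤ ω(k)` for `ω₂ ≥ 0`. [folklore] -/
theorem two_abs_sin_half_le_dispersionR {ω₂ : ℝ} (hω : 0 ≤ ω₂) (k : ℝ) :
    2 * |Real.sin (k / 2)| ≤ dispersionR ω₂ k := by
  have h1 : (2 * |Real.sin (k / 2)|) ^ 2 ≤ dispersionR ω₂ k ^ 2 := by
    rw [dispersionR_sq ω₂ hω, mul_pow, sq_abs]; linarith
  exact (pow_le_pow_iff_left₀ (by positivity) (dispersionR_nonneg _ _) two_ne_zero).1 h1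

/-- **Only pair collisions are resonant on the pinned band**: strict subadditivity
`ω(a + b) < ω(a) + ω(b)` for `ω₂ > 0`. With `ω ≥ √ω₂ > 0` this rules out all `3 ↔ 1` and
`4 ↔ 0` four-phonon resonances (see `threeOne_nonresonant`), so energy–momentum conservation
forces phonon-number conservation. [cite: Lukkarinen2016, §2.2.1–2.2.2] -/
theorem dispersionR_add_lt {ω₂ : ℝ} (hω : 0 < ω₂) (a b : ℝ) :
    dispersionR ω₂ (a + b) < dispersionR ω₂ a + dispersionR ω₂ b := by
  set A := dispersionR ω₂ a with hA
  set B := dispersionR ω₂ b with hB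
  have hApos : 0 < A := dispersionR_pos hω a
  have hBpos : 0 < B := dispersionR_pos hω b
  have hA2 : A ^ 2 = ω₂ + 4 * Real.sin (a / 2) ^ 2 := dispersionR_sq ω₂ hω.le a
  have hB2 : B ^ 2 = ω₂ + 4 * Real.sin (b / 2) ^ 2 := dispersionR_sq ω₂ hω.le b
  have hAs : 2 * |Real.sin (a / 2)| ≤ A := two_abs_sin_half_le_dispersionR hω.le a
  have hBs : 2 * |Real.sin (b / 2)| ≤ B := two_abs_sin_half_le_dispersionR hω.le b
  -- `sin((a+b)/2) = sin(a/2)cos(b/2) + cos(a/2)sin(b/2)` is at most `|sin(a/2)| + |sin(b/2)|`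
  have hsum : |Real.sin ((a + b) / 2)| ≤ |Real.sin (a / 2)| + |Real.sin (b / 2)| := by
    have : (a + b) / 2 = a / 2 + b / 2 := by ring
    rw [this, Real.sin_add]
    refine (abs_add_le _ _).trans (add_le_add ?_ ?_)
    · rw [abs_mul]
      exact mul_le_of_le_one_right (abs_nonneg _) (Real.abs_cos_le_one _)
    · rw [abs_mul]
      exact mul_le_of_le_one_left (abs_nonneg _) (Real.abs_cos_le_one _)
  have hsq : Real.sin ((a + b) / 2) ^ 2 ≤ (|Real.sin (a / 2)| + |Real.sin (b / 2)|) ^ 2 := by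
    rw [← sq_abs]
    exact pow_le_pow_left₀ (abs_nonneg _) hsum 2
  have hprod : 4 * (|Real.sin (a / 2)| * |Real.sin (b / 2)|) ≤ A * B := by
    have := mul_le_mul hAs hBs (by positivity) hApos.le
    linarith
  have hc : Real.cos (a + b) = 1 - 2 * Real.sin ((a + b) / 2) ^ 2 := by
    have h2 : Real.cos (a + b) = Real.cos (2 * ((a + b) / 2)) := by ring_nf
    rw [h2, Real.cos_two_mul, Real.cos_sq']
    ring
  unfold dispersionR
  rw [Real.sqrt_lt' (by linarith), hc]
  nlinarith [sq_abs (Real.sin (a / 2)), sq_abs (Real.sin (b / 2)), hsq, hprod, hA2, hB2]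

/-- No `3 ↔ 1` resonance: `ω(k₁ + k₂ + k₃) < ω(k₁) + ω(k₂) + ω(k₃)` for `ω₂ > 0` (and a fortiori
no `4 ↔ 0` resonance, all `ω > 0`). [cite: Lukkarinen2016, §2.2.2] -/
theorem threeOne_nonresonant {ω₂ : ℝ} (hω : 0 < ω₂) (k₁ k₂ k₃ : ℝ) :
    dispersionR ω₂ (k₁ + k₂ + k₃) < dispersionR ω₂ k₁ + dispersionR ω₂ k₂ + dispersionR ω₂ k₃ :=
  (dispersionR_add_lt hω (k₁ + k₂) k₃).trans (by linarith [dispersionR_add_lt hω k₁ k₂])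

/-! ### Collisional invariants (Spohn 2006; LS2008 Def. 2.1) and the open kernel statement -/

/-- The pair-collision RESONANT SET of the pinned band in `ℝ³` (momentum conservation used to
eliminate `k₄ = k₁ + k₂ - k₃`): `{(k₁,k₂,k₃) : ω(k₁) + ω(k₂) = ω(k₃) + ω(k₁ + k₂ - k₃)}`.
It contains the label-exchange planes `k₁ = k₃`, `k₂ = k₃` and the non-perturbative branch
`k₂ = h(k₁;k₃)`. [cite: AokiLukkarinenSpohn2006, §4 eqs. (4.2)–(4.6)] -/
def resonantSet (ω₂ : ℝ) : Set (ℝ × ℝ × ℝ) :=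
  {k | dispersionR ω₂ k.1 + dispersionR ω₂ k.2.1 =
    dispersionR ω₂ k.2.2 + dispersionR ω₂ (k.1 + k.2.1 - k.2.2)}

/-- The resonant set is closed. [folklore] -/
theorem isClosed_resonantSet (ω₂ : ℝ) : IsClosed (resonantSet ω₂) := by
  have hc : Continuous (dispersionR ω₂) := by unfold dispersionR; fun_prop
  exact isClosed_eq (by fun_prop) (by fun_prop)

/-- The resonant set is measurable. [folklore] -/
theorem measurableSet_resonantSet (ω₂ : ℝ) : MeasurableSet (resonantSet ω₂) :=
  (isClosed_resonantSet ω₂).measurableSet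

/-- A COLLISIONAL INVARIANT of the pair-collision operator of the pinned band: a measurable
`2π`-periodic `ψ : ℝ → ℝ` with `ψ(k₁) + ψ(k₂) = ψ(k₃) + ψ(k₁ + k₂ - k₃)` for almost every point of
the resonant set with respect to two-dimensional Hausdorff measure (= Lebesgue measure on every
two-dimensional submanifold of the solution set). [cite: LukkarinenSpohn2008, Definition 2.1] -/
def IsCollisionalInvariant (ω₂ : ℝ) (ψ : ℝ → ℝ) : Prop :=
  Measurable ψ ∧ Periodic ψ (2 * Real.pi) ∧
    ∀ᵐ k ∂(μH[2]).restrict (resonantSet ω₂),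
      ψ k.1 + ψ k.2.1 = ψ k.2.2 + ψ (k.1 + k.2.1 - k.2.2)

/-- Sufficient condition: a measurable periodic `ψ` satisfying the invariant identity at EVERY
resonant point is a collisional invariant. [folklore] -/
theorem isCollisionalInvariant_of_forall {ω₂ : ℝ} {ψ : ℝ → ℝ} (hm : Measurable ψ)
    (hp : Periodic ψ (2 * Real.pi))
    (h : ∀ k₁ k₂ k₃ : ℝ, dispersionR ω₂ k₁ + dispersionR ω₂ k₂ =
      dispersionR ω₂ k₃ + dispersionR ω₂ (k₁ + k₂ - k₃) → ψ k₁ + ψ k₂ = ψ k₃ + ψ (k₁ + k₂ - k₃)) :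
    IsCollisionalInvariant ω₂ ψ := by
  refine ⟨hm, hp, (ae_restrict_iff' (measurableSet_resonantSet ω₂)).2 (ae_of_all _ ?_)⟩
  rintro ⟨k₁, k₂, k₃⟩ hk
  exact h k₁ k₂ k₃ hk

/-- The obvious invariants: `a·ω + c` is a collisional invariant for all `a c : ℝ`.
[cite: AokiLukkarinenSpohn2006, §4 eq. (4.10)] -/
theorem isCollisionalInvariant_affine_dispersionR (ω₂ a c : ℝ) :
    IsCollisionalInvariant ω₂ (fun k => a * dispersionR ω₂ k + c) := by
  refine isCollisionalInvariant_of_forall ?_ ?_ ?_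
  · exact (by unfold dispersionR; fun_prop : Continuous fun k => a * dispersionR ω₂ k + c).measurable
  · intro k
    simp only [(dispersionR_periodic ω₂) k]
  · intro k₁ k₂ k₃ hk
    linear_combination a * hk

/-- **`ker L = span{1, ω}`** for the pinned band (the statement `kerCollision_eq_span` requested by
route KineticCorner): every locally integrable collisional invariant is a.e. of the form
`a·ω + c`. OPEN for the pinned chain (`d = 1`): "We expect that there are no further solutions, but
no proof is available, at present" — proved for `d ≥ 2` (Spohn 2006, Proposition) and for the
FPU band `ω = sin(k/2)` (Lukkarinen–Spohn 2008, Thm 2.2). As `ω₂ → ∞` (`δ → 0`) the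
non-perturbative branch degenerates to `k₁ + k₂ = π` and the kernel becomes infinite-dimensional
(all `f` with `f(k) + f(π - k) = 0`). A conjecture (`def … : Prop`), never asserted.
[cite: AokiLukkarinenSpohn2006, §4 eqs. (4.9)–(4.10)] -/
def KerCollisionEqSpan (ω₂ : ℝ) : Prop :=
  ∀ ψ : ℝ → ℝ, LocallyIntegrable ψ volume → IsCollisionalInvariant ω₂ ψ →
    ∃ a c : ℝ, ψ =ᵐ[volume] fun k => a * dispersionR ω₂ k + c

/-! ### Momentum space `𝕋 = ℝ/2πℤ`, its probability Haar measure, and the band on `𝕋` -/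

namespace PinnedChainKinetic

/-- `0 < 2π` as a `Fact` (Mathlib keeps this instance local; scoped to this namespace).
[folklore] -/
scoped instance instFactTwoPiPos : Fact (0 < 2 * Real.pi) := ⟨Real.two_pi_pos⟩

/-- Momentum space: the Brillouin zone as the circle `ℝ/2πℤ` (angle variable; ALS's
`k ∈ [-1/2, 1/2]` is `k/2π`). [cite: AokiLukkarinenSpohn2006, §3] -/
abbrev 𝕋 : Type := AddCircle (2 * Real.pi)

/-- The Haar PROBABILITY measure `dk` on `𝕋` (= ALS's `∫_{-1/2}^{1/2} dk`). [folklore] -/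
abbrev μ𝕋 : Measure 𝕋 := AddCircle.haarAddCircle

/-- Three momenta `(k₁, k₂, k₃)` (the fourth is `k₁ + k₂ - k₃`). [folklore] -/
abbrev 𝕋3 : Type := 𝕋 × 𝕋 × 𝕋

/-- Product probability measure `dk₁dk₂dk₃` on `𝕋3`. [folklore] -/
abbrev μ𝕋3 : Measure 𝕋3 := μ𝕋.prod (μ𝕋.prod μ𝕋)

/-- The real Hilbert space `H = L²(𝕋, dk)` on which the collision operator acts.
[cite: AokiLukkarinenSpohn2006, §3 after eq. (3.20)] -/
abbrev H : Type := Lp ℝ 2 μ𝕋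

/-- `L²(𝕋3, dk₁dk₂dk₃)`, the target of the collision-difference map. [folklore] -/
abbrev H₃ : Type := Lp ℝ 2 μ𝕋3

/-- `cos` on the circle `ℝ/2πℤ`. [folklore] -/
def cosT : 𝕋 → ℝ := Real.cos_periodic.lift

/-- `sin` on the circle `ℝ/2πℤ`. [folklore] -/
def sinT : 𝕋 → ℝ := Real.sin_periodic.lift

/-- `cosT ↑x = cos x`. [folklore] -/
@[simp] theorem cosT_coe (x : ℝ) : cosT (x : 𝕋) = Real.cos x := rfl

/-- `sinT ↑x = sin x`. [folklore] -/
@[simp] theorem sinT_coe (x : ℝ) : sinT (x : 𝕋) = Real.sin x := rfl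

/-- `cosT` is continuous. [folklore] -/
theorem continuous_cosT : Continuous cosT := Real.continuous_cos.quotient_liftOn' _

/-- `sinT` is continuous. [folklore] -/
theorem continuous_sinT : Continuous sinT := Real.continuous_sin.quotient_liftOn' _

/-- `|cosT| ≤ 1`. [folklore] -/
theorem abs_cosT_le_one (k : 𝕋) : |cosT k| ≤ 1 := by
  induction k using QuotientAddGroup.induction_on
  exact Real.abs_cos_le_one _

/-- `cosT` is even. [folklore] -/
theorem cosT_neg (k : 𝕋) : cosT (-k) = cosT k := by
  induction k using QuotientAddGroup.induction_on
  rw [← AddCircle.coe_neg, cosT_coe, cosT_coe, Real.cos_neg]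

/-- `sinT` is odd. [folklore] -/
theorem sinT_neg (k : 𝕋) : sinT (-k) = -sinT k := by
  induction k using QuotientAddGroup.induction_on
  rw [← AddCircle.coe_neg, sinT_coe, sinT_coe, Real.sin_neg]

/-- The band on the circle: `ω(k) = √(ω₂ + 2(1 - cos k))`, the descent of `dispersionR`.
[cite: AokiLukkarinenSpohn2006, §3 eq. (3.4)] -/
def dispersion (ω₂ : ℝ) (k : 𝕋) : ℝ := Real.sqrt (ω₂ + 2 * (1 - cosT k))

/-- `ω` is even on `𝕋` (an even collisional weight: the parity sectors decouple). [folklore] -/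
theorem dispersion_neg (ω₂ : ℝ) (k : 𝕋) : dispersion ω₂ (-k) = dispersion ω₂ k := by
  simp [dispersion, cosT_neg]

/-- `dispersion ω₂ ↑x = dispersionR ω₂ x`. [folklore] -/
@[simp] theorem dispersion_coe (ω₂ x : ℝ) : dispersion ω₂ (x : 𝕋) = dispersionR ω₂ x := rfl

/-- `ω` is continuous on `𝕋`. [folklore] -/
theorem continuous_dispersion (ω₂ : ℝ) : Continuous (dispersion ω₂) := by
  have hc := continuous_cosT
  unfold dispersion
  fun_prop

/-- `√ω₂ ≤ ω` on `𝕋`. [folklore] -/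
theorem sqrt_le_dispersion (ω₂ : ℝ) (k : 𝕋) : Real.sqrt ω₂ ≤ dispersion ω₂ k := by
  induction k using QuotientAddGroup.induction_on
  exact sqrt_le_dispersionR ω₂ _

/-- `0 ≤ ω` on `𝕋`. [folklore] -/
theorem dispersion_nonneg (ω₂ : ℝ) (k : 𝕋) : 0 ≤ dispersion ω₂ k := Real.sqrt_nonneg _

/-- `ω ≠ 0` on `𝕋` for `ω₂ > 0`. [folklore] -/
theorem dispersion_ne_zero {ω₂ : ℝ} (hω : 0 < ω₂) (k : 𝕋) : dispersion ω₂ k ≠ 0 :=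
  (lt_of_lt_of_le (Real.sqrt_pos.2 hω) (sqrt_le_dispersion ω₂ k)).ne'

/-- `ω ≤ √(|ω₂| + 4)` on `𝕋`. [folklore] -/
theorem dispersion_le (ω₂ : ℝ) (k : 𝕋) : dispersion ω₂ k ≤ Real.sqrt (|ω₂| + 4) := by
  unfold dispersion
  refine Real.sqrt_le_sqrt ?_
  have h1 := le_abs_self ω₂
  have h2 : -1 ≤ cosT k := (abs_le.1 (abs_cosT_le_one k)).1
  linarith

/-- The current weight on the circle, `ṽ = ω' = sin/ω`.
[cite: AokiLukkarinenSpohn2006, §3 eq. (3.9)] -/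
def currentWeight (ω₂ : ℝ) (k : 𝕋) : ℝ := sinT k / dispersion ω₂ k

/-- `currentWeight ω₂ ↑x = pinnedChainCurrentWeight ω₂ x`. [folklore] -/
@[simp] theorem currentWeight_coe (ω₂ x : ℝ) :
    currentWeight ω₂ (x : 𝕋) = pinnedChainCurrentWeight ω₂ x := rfl

/-- `ṽ = ω'` is odd on `𝕋` (the current weight lives in the odd sector). [folklore] -/
theorem currentWeight_neg (ω₂ : ℝ) (k : 𝕋) : currentWeight ω₂ (-k) = -currentWeight ω₂ k := by
  simp [currentWeight, sinT_neg, dispersion_neg, neg_div]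

/-- `ṽ` is continuous on `𝕋` for `ω₂ > 0`. [folklore] -/
theorem continuous_currentWeight {ω₂ : ℝ} (hω : 0 < ω₂) : Continuous (currentWeight ω₂) :=
  continuous_sinT.div (continuous_dispersion ω₂) (dispersion_ne_zero hω)

/-- The fourth momentum of the pair process, `k₄ = k₁ + k₂ - k₃` (momentum conservation on
`𝕋`, umklapp included). [cite: AokiLukkarinenSpohn2006, §4 after eq. (4.1)] -/
def k₄ (k : 𝕋3) : 𝕋 := k.1 + k.2.1 - k.2.2

/-- The BOND VERTEX FACTOR of the FPU-`β` quartic coupling for the pair process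
`(k₁, k₂) → (k₃, k₄)`: `B = Re[(e^{ik₁} - 1)(e^{ik₂} - 1)(e^{-ik₃} - 1)(e^{-ik₄} - 1)]`, written
out as a trigonometric polynomial (`k₄ = k₁ + k₂ - k₃`); equals
`16 sin(k₁/2) sin(k₂/2) sin(k₃/2) sin(k₄/2)` on real representatives (`bondVertex_coe`).
This is `α̂₄/λ₄ = 2 Re ∏_{ℓ=1}^{3}(1 - e^{-ik_ℓ})` of Lukkarinen 2016 on the momentum
constraint. [cite: Lukkarinen2016, §1.3 (Fourier transform `α̂₄` of the FPU chain)] -/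
def bondVertex (k : 𝕋3) : ℝ :=
  2 + 2 * cosT (k.1 + k.2.1) + 2 * cosT (k.1 - k.2.2) + 2 * cosT (k.2.1 - k.2.2)
    - 2 * cosT k.1 - 2 * cosT k.2.1 - 2 * cosT k.2.2 - 2 * cosT (k₄ k)

/-- `B = 16 ∏ sin(k_ℓ/2)` on real representatives with `k₄ = k₁ + k₂ - k₃` taken in `ℝ`.
[cite: Lukkarinen2016, §1.3] -/
theorem bondVertex_coe (a b c : ℝ) :
    bondVertex ((a : 𝕋), (b : 𝕋), (c : 𝕋)) =
      16 * Real.sin (a / 2) * Real.sin (b / 2) * Real.sin (c / 2) * Real.sin ((a + b - c) / 2) := by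
  have h4 : k₄ ((a : 𝕋), (b : 𝕋), (c : 𝕋)) = ((a + b - c : ℝ) : 𝕋) := by
    simp only [k₄, AddCircle.coe_add, AddCircle.coe_sub]
  have e : bondVertex ((a : 𝕋), (b : 𝕋), (c : 𝕋)) =
      2 + 2 * Real.cos (a + b) + 2 * Real.cos (a - c) + 2 * Real.cos (b - c)
        - 2 * Real.cos a - 2 * Real.cos b - 2 * Real.cos c - 2 * Real.cos (a + b - c) := by
    simp only [bondVertex, h4, ← AddCircle.coe_add, ← AddCircle.coe_sub, cosT_coe]
  rw [e]
  -- product-to-sum: `16 s s s s = 4 (2 sin sin) (2 sin sin)`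
  have e1 : 2 * Real.sin (a / 2) * Real.sin (b / 2) =
      Real.cos (a / 2 - b / 2) - Real.cos (a / 2 + b / 2) := Real.two_mul_sin_mul_sin _ _
  have e2 : 2 * Real.sin (c / 2) * Real.sin ((a + b - c) / 2) =
      Real.cos (c / 2 - (a + b - c) / 2) - Real.cos (c / 2 + (a + b - c) / 2) :=
    Real.two_mul_sin_mul_sin _ _
  have e3 : 2 * Real.cos (a / 2 - b / 2) * Real.cos (c / 2 - (a + b - c) / 2) =
      Real.cos (a - c) + Real.cos (b - c) := by
    rw [Real.two_mul_cos_mul_cos]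
    have h₁ : a / 2 - b / 2 - (c / 2 - (a + b - c) / 2) = a - c := by ring
    have h₂ : a / 2 - b / 2 + (c / 2 - (a + b - c) / 2) = -(b - c) := by ring
    rw [h₁, h₂, Real.cos_neg]
  have e4 : 2 * Real.cos (a / 2 - b / 2) * Real.cos (c / 2 + (a + b - c) / 2) =
      Real.cos b + Real.cos a := by
    rw [Real.two_mul_cos_mul_cos]
    have h₁ : a / 2 - b / 2 - (c / 2 + (a + b - c) / 2) = -b := by ring
    have h₂ : a / 2 - b / 2 + (c / 2 + (a + b - c) / 2) = a := by ring
    rw [h₁, h₂, Real.cos_neg]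
  have e5 : 2 * Real.cos (a / 2 + b / 2) * Real.cos (c / 2 - (a + b - c) / 2) =
      Real.cos (a + b - c) + Real.cos c := by
    rw [Real.two_mul_cos_mul_cos]
    have h₁ : a / 2 + b / 2 - (c / 2 - (a + b - c) / 2) = a + b - c := by ring
    have h₂ : a / 2 + b / 2 + (c / 2 - (a + b - c) / 2) = c := by ring
    rw [h₁, h₂]
  have e6 : 2 * Real.cos (a / 2 + b / 2) * Real.cos (c / 2 + (a + b - c) / 2) =
      1 + Real.cos (a + b) := by
    rw [Real.two_mul_cos_mul_cos]
    have h₁ : a / 2 + b / 2 - (c / 2 + (a + b - c) / 2) = 0 := by ring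
    have h₂ : a / 2 + b / 2 + (c / 2 + (a + b - c) / 2) = a + b := by ring
    rw [h₁, h₂, Real.cos_zero]
  have key : 16 * Real.sin (a / 2) * Real.sin (b / 2) * Real.sin (c / 2) *
      Real.sin ((a + b - c) / 2) =
      4 * ((2 * Real.sin (a / 2) * Real.sin (b / 2)) *
        (2 * Real.sin (c / 2) * Real.sin ((a + b - c) / 2))) := by ring
  rw [key, e1, e2]
  linear_combination (-2) * e3 + 2 * e4 + 2 * e5 - 2 * e6

/-- `|B| ≤ 16`. [folklore] -/
theorem abs_bondVertex_le (k : 𝕋3) : |bondVertex k| ≤ 16 := by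
  have h1 := abs_le.1 (abs_cosT_le_one (k.1 + k.2.1))
  have h2 := abs_le.1 (abs_cosT_le_one (k.1 - k.2.2))
  have h3 := abs_le.1 (abs_cosT_le_one (k.2.1 - k.2.2))
  have h4 := abs_le.1 (abs_cosT_le_one k.1)
  have h5 := abs_le.1 (abs_cosT_le_one k.2.1)
  have h6 := abs_le.1 (abs_cosT_le_one k.2.2)
  have h7 := abs_le.1 (abs_cosT_le_one (k₄ k))
  rw [abs_le]
  unfold bondVertex
  constructor <;> linarith [h1.1, h1.2, h2.1, h2.2, h3.1, h3.2, h4.1, h4.2, h5.1, h5.2, h6.1,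
    h6.2, h7.1, h7.2]

/-- `B` is continuous. [folklore] -/
theorem continuous_bondVertex : Continuous bondVertex := by
  have hc := continuous_cosT
  unfold bondVertex k₄
  fun_prop

/-- The COMBINED QUARTIC VERTEX of `pinnedChain ω₂ lam β γ` for the pair process:
`v = lam + β·B` (on-site `lam q⁴/4` gives the constant `lam` — ALS's `λ`; the bond term
`β(q_{x+1} - q_x)⁴/4` gives `β·B`).
[cite: Lukkarinen2016, §1.3 (`α̂₄` of on-site and FPU perturbations)] -/
def vertex (lam β : ℝ) (k : 𝕋3) : ℝ := lam + β * bondVertex k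

/-- `|v| ≤ |lam| + 16|β|`. [folklore] -/
theorem abs_vertex_le (lam β : ℝ) (k : 𝕋3) : |vertex lam β k| ≤ |lam| + 16 * |β| := by
  unfold vertex
  refine (abs_add_le _ _).trans (add_le_add le_rfl ?_)
  rw [abs_mul]
  nlinarith [abs_bondVertex_le k, abs_nonneg β, abs_nonneg (bondVertex k)]

/-- `v` is continuous. [folklore] -/
theorem continuous_vertex (lam β : ℝ) : Continuous (vertex lam β) := by
  have hB := continuous_bondVertex
  unfold vertex
  fun_prop

/-- The pair-collision RESONANCE FUNCTION `Ω(k₁,k₂,k₃) = ω(k₁) + ω(k₂) - ω(k₃) - ω(k₁ + k₂ - k₃)`.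
[cite: AokiLukkarinenSpohn2006, §4 eq. (4.2)] -/
def resonanceFn (ω₂ : ℝ) (k : 𝕋3) : ℝ :=
  dispersion ω₂ k.1 + dispersion ω₂ k.2.1 - dispersion ω₂ k.2.2 - dispersion ω₂ (k₄ k)

/-- `Ω` is continuous. [folklore] -/
theorem continuous_resonanceFn (ω₂ : ℝ) : Continuous (resonanceFn ω₂) := by
  have hd := continuous_dispersion ω₂
  unfold resonanceFn k₄
  fun_prop

/-- The regularised `δ`-function `δ_ε(s) = ε/(π(s² + ε²))` used to DEFINE the collision operator.
[cite: LukkarinenSpohn2008, §3 eq. (3.1)] -/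
def deltaReg (ε s : ℝ) : ℝ := ε / (Real.pi * (s ^ 2 + ε ^ 2))

/-- `δ_ε ≥ 0` for `ε ≥ 0`. [folklore] -/
theorem deltaReg_nonneg {ε : ℝ} (hε : 0 ≤ ε) (s : ℝ) : 0 ≤ deltaReg ε s := by
  unfold deltaReg; positivity

/-- `δ_ε ≤ (πε)⁻¹` for `ε > 0`. [folklore] -/
theorem deltaReg_le {ε : ℝ} (hε : 0 < ε) (s : ℝ) : deltaReg ε s ≤ 1 / (Real.pi * ε) := by
  unfold deltaReg
  rw [div_le_div_iff₀ (by positivity) (by positivity)]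
  nlinarith [Real.pi_pos, sq_nonneg s, hε, mul_nonneg Real.pi_pos.le (sq_nonneg s)]

/-- `δ_ε` is continuous for `ε > 0`. [folklore] -/
theorem continuous_deltaReg {ε : ℝ} (hε : 0 < ε) : Continuous (deltaReg ε) := by
  unfold deltaReg
  refine continuous_const.div (by fun_prop) fun s => ?_
  positivity

/-- The `ε`-REGULARISED COLLISION WEIGHT of the linearised pair-collision operator at unit
temperature: `W_ε(k₁,k₂,k₃) = (9π/16)·v²·(ω₁ω₂ω₃ω₄)⁻²·δ_ε(Ω)` (`k₄ = k₁ + k₂ - k₃`), i.e. the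
integrand of ALS (4.1) with `λ² ↦ v²` and `δ ↦ δ_ε`.
[cite: AokiLukkarinenSpohn2006, §4 eq. (4.1)] -/
def collisionWeight (ω₂ lam β ε : ℝ) (k : 𝕋3) : ℝ :=
  9 * Real.pi / 16 * vertex lam β k ^ 2 *
    ((dispersion ω₂ k.1 * dispersion ω₂ k.2.1 * dispersion ω₂ k.2.2 *
      dispersion ω₂ (k₄ k))⁻¹) ^ 2 *
    deltaReg ε (resonanceFn ω₂ k)

/-- `W_ε ≥ 0` for `ε ≥ 0`. [folklore] -/
theorem collisionWeight_nonneg (ω₂ lam β : ℝ) {ε : ℝ} (hε : 0 ≤ ε) (k : 𝕋3) :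
    0 ≤ collisionWeight ω₂ lam β ε k := by
  unfold collisionWeight
  have := deltaReg_nonneg hε (resonanceFn ω₂ k)
  positivity

/-- `W_ε` is continuous for `ω₂, ε > 0`. [folklore] -/
theorem continuous_collisionWeight (ω₂ lam β : ℝ) {ε : ℝ} (hω : 0 < ω₂) (hε : 0 < ε) :
    Continuous (collisionWeight ω₂ lam β ε) := by
  have hne := dispersion_ne_zero hω
  have hd := continuous_dispersion ω₂
  have hv := continuous_vertex lam β
  have hP : Continuous fun k : 𝕋3 =>
      (dispersion ω₂ k.1 * dispersion ω₂ k.2.1 * dispersion ω₂ k.2.2 * dispersion ω₂ (k₄ k))⁻¹ := by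
    refine Continuous.inv₀ ?_ fun k =>
      mul_ne_zero (mul_ne_zero (mul_ne_zero (hne _) (hne _)) (hne _)) (hne _)
    unfold k₄
    fun_prop
  have hδ : Continuous fun k : 𝕋3 => deltaReg ε (resonanceFn ω₂ k) :=
    (continuous_deltaReg hε).comp (continuous_resonanceFn ω₂)
  unfold collisionWeight
  exact ((continuous_const.mul (hv.pow 2)).mul (hP.pow 2)).mul hδ

/-- The explicit bound `W_ε ≤ (9π/16)(|lam| + 16|β|)² ω₂⁻⁴ (πε)⁻¹` for `ω₂, ε > 0`. [folklore] -/
theorem collisionWeight_le {ω₂ lam β ε : ℝ} (hω : 0 < ω₂) (hε : 0 < ε) (k : 𝕋3) :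
    collisionWeight ω₂ lam β ε k ≤
      9 * Real.pi / 16 * (|lam| + 16 * |β|) ^ 2 * (ω₂ ^ 2)⁻¹ ^ 2 * (1 / (Real.pi * ε)) := by
  unfold collisionWeight
  have hs : 0 < Real.sqrt ω₂ := Real.sqrt_pos.2 hω
  have hd : ∀ k : 𝕋, Real.sqrt ω₂ ≤ dispersion ω₂ k := sqrt_le_dispersion ω₂
  have h0 := dispersion_nonneg ω₂
  have hv : vertex lam β k ^ 2 ≤ (|lam| + 16 * |β|) ^ 2 := by
    rw [← sq_abs]; exact pow_le_pow_left₀ (abs_nonneg _) (abs_vertex_le lam β k) 2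
  set P := dispersion ω₂ k.1 * dispersion ω₂ k.2.1 * dispersion ω₂ k.2.2 * dispersion ω₂ (k₄ k)
    with hPdef
  have hP : ω₂ ^ 2 ≤ P := by
    have e : ω₂ ^ 2 = Real.sqrt ω₂ * Real.sqrt ω₂ * Real.sqrt ω₂ * Real.sqrt ω₂ := by
      rw [show Real.sqrt ω₂ * Real.sqrt ω₂ * Real.sqrt ω₂ * Real.sqrt ω₂ =
        (Real.sqrt ω₂ ^ 2) ^ 2 by ring, Real.sq_sqrt hω.le]
    rw [e, hPdef]
    exact mul_le_mul (mul_le_mul (mul_le_mul (hd k.1) (hd k.2.1) hs.le (h0 _)) (hd k.2.2) hs.le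
      (mul_nonneg (h0 _) (h0 _))) (hd (k₄ k)) hs.le (mul_nonneg (mul_nonneg (h0 _) (h0 _)) (h0 _))
  have hω2 : 0 < ω₂ ^ 2 := by positivity
  have hPpos : 0 < P := lt_of_lt_of_le hω2 hP
  have hinv : P⁻¹ ^ 2 ≤ (ω₂ ^ 2)⁻¹ ^ 2 :=
    pow_le_pow_left₀ (inv_nonneg.2 hPpos.le) ((inv_le_inv₀ hPpos hω2).2 hP) 2
  have hδ := deltaReg_le hε (resonanceFn ω₂ k)
  have hδ0 := deltaReg_nonneg hε.le (resonanceFn ω₂ k)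
  have hc : (0 : ℝ) ≤ 9 * Real.pi / 16 := by positivity
  have step1 : 9 * Real.pi / 16 * vertex lam β k ^ 2 ≤ 9 * Real.pi / 16 * (|lam| + 16 * |β|) ^ 2 :=
    mul_le_mul_of_nonneg_left hv hc
  have step2 : 9 * Real.pi / 16 * vertex lam β k ^ 2 * P⁻¹ ^ 2 ≤
      9 * Real.pi / 16 * (|lam| + 16 * |β|) ^ 2 * (ω₂ ^ 2)⁻¹ ^ 2 :=
    mul_le_mul step1 hinv (by positivity) (by positivity)
  exact mul_le_mul step2 hδ hδ0 (by positivity)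

/-! ### Measure-preserving coordinate maps `𝕋3 → 𝕋` and the collision-difference map -/

/-- `(k₁,k₂,k₃) ↦ k₁` preserves the probability measures. [folklore] -/
theorem measurePreserving_k1 : MeasurePreserving (fun k : 𝕋3 => k.1) μ𝕋3 μ𝕋 :=
  measurePreserving_fst

/-- `(k₁,k₂,k₃) ↦ k₂` preserves the probability measures. [folklore] -/
theorem measurePreserving_k2 : MeasurePreserving (fun k : 𝕋3 => k.2.1) μ𝕋3 μ𝕋 :=
  measurePreserving_fst.comp measurePreserving_snd

/-- `(k₁,k₂,k₃) ↦ k₃` preserves the probability measures. [folklore] -/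
theorem measurePreserving_k3 : MeasurePreserving (fun k : 𝕋3 => k.2.2) μ𝕋3 μ𝕋 :=
  measurePreserving_snd.comp measurePreserving_snd

/-- `(k₁,k₂,k₃) ↦ k₁ + k₂ - k₃` pushes `dk₁dk₂dk₃` to `dk` (a shear followed by a projection).
[folklore] -/
theorem measurePreserving_k₄ : MeasurePreserving k₄ μ𝕋3 μ𝕋 := by
  have hS : MeasurePreserving (fun p : (𝕋 × 𝕋) × 𝕋 => (id p.1, p.2 + (p.1.1 - p.1.2)))
      ((μ𝕋.prod μ𝕋).prod μ𝕋) ((μ𝕋.prod μ𝕋).prod μ𝕋) := by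
    refine (MeasurePreserving.id _).skew_product (g := fun (q : 𝕋 × 𝕋) (k : 𝕋) => k + (q.1 - q.2))
      ?_ ?_
    · exact measurable_snd.add (measurable_fst.fst.sub measurable_fst.snd)
    · exact ae_of_all _ fun q => map_add_right_eq_self μ𝕋 (q.1 - q.2)
  have hswap : MeasurePreserving (Prod.swap : 𝕋 × (𝕋 × 𝕋) → (𝕋 × 𝕋) × 𝕋) μ𝕋3
      ((μ𝕋.prod μ𝕋).prod μ𝕋) := Measure.measurePreserving_swap
  have hsnd : MeasurePreserving (Prod.snd : (𝕋 × 𝕋) × 𝕋 → 𝕋) ((μ𝕋.prod μ𝕋).prod μ𝕋) μ𝕋 :=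
    measurePreserving_snd
  have h := hsnd.comp (hS.comp hswap)
  have heq : (Prod.snd ∘ (fun p : (𝕋 × 𝕋) × 𝕋 => (id p.1, p.2 + (p.1.1 - p.1.2))) ∘ Prod.swap) =
      (k₄ : 𝕋3 → 𝕋) := by
    funext k
    simp only [comp_apply, Prod.fst_swap, Prod.snd_swap, k₄]
    abel
  rwa [heq] at h

/-- Pull-back of `L²(𝕋)` along a measure-preserving coordinate map, as a bounded operator
`H → H₃` (an isometry). [folklore] -/
def pull (π : 𝕋3 → 𝕋) (h : MeasurePreserving π μ𝕋3 μ𝕋) : H →L[ℝ] H₃ :=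
  (Lp.compMeasurePreservingₗᵢ ℝ π h).toContinuousLinearMap

/-- `pull π h f = f ∘ π` almost everywhere. [folklore] -/
theorem coeFn_pull (π : 𝕋3 → 𝕋) (h : MeasurePreserving π μ𝕋3 μ𝕋) (f : H) :
    pull π h f =ᵐ[μ𝕋3] fun k => f (π k) :=
  Lp.coeFn_compMeasurePreserving f h

/-- The COLLISION-DIFFERENCE map `D f (k₁,k₂,k₃) = f(k₁) + f(k₂) - f(k₃) - f(k₁ + k₂ - k₃)`,
`H → L²(𝕋3)`, bounded (`‖D‖ ≤ 4`). [cite: AokiLukkarinenSpohn2006, §4 eq. (4.1)] -/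
def collisionDifference : H →L[ℝ] H₃ :=
  pull _ measurePreserving_k1 + pull _ measurePreserving_k2 - pull _ measurePreserving_k3 -
    pull _ measurePreserving_k₄

/-- `D f = f₁ + f₂ - f₃ - f₄` almost everywhere. [folklore] -/
theorem coeFn_collisionDifference (f : H) :
    collisionDifference f =ᵐ[μ𝕋3] fun k => f k.1 + f k.2.1 - f k.2.2 - f (k₄ k) := by
  unfold collisionDifference
  simp only [FunLike.coe_sub, FunLike.coe_add, Pi.sub_apply, Pi.add_apply]
  filter_upwards [coeFn_pull _ measurePreserving_k1 f, coeFn_pull _ measurePreserving_k2 f,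
    coeFn_pull _ measurePreserving_k3 f, coeFn_pull _ measurePreserving_k₄ f,
    Lp.coeFn_sub (pull _ measurePreserving_k1 f + pull _ measurePreserving_k2 f -
      pull _ measurePreserving_k3 f) (pull _ measurePreserving_k₄ f),
    Lp.coeFn_sub (pull _ measurePreserving_k1 f + pull _ measurePreserving_k2 f)
      (pull _ measurePreserving_k3 f),
    Lp.coeFn_add (pull _ measurePreserving_k1 f) (pull _ measurePreserving_k2 f)]
    with k h1 h2 h3 h4 h5 h6 h7
  rw [h5, Pi.sub_apply, h6, Pi.sub_apply, h7, Pi.add_apply, h1, h2, h3, h4]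

/-! ### Multiplication operators by bounded weights (Hölder action of `L^∞` on `L²`) -/

section Multiplier

variable {X : Type*} [MeasurableSpace X] (ν : Measure X)

/-- Essential boundedness of a real weight. [folklore] -/
def IsBddAE (m : X → ℝ) : Prop :=
  AEStronglyMeasurable m ν ∧ ∃ C : ℝ, ∀ᵐ x ∂ν, ‖m x‖ ≤ C

open Classical in
/-- Multiplication by an essentially bounded real weight `m` as a bounded operator on `L²(ν)`
(junk value `0` if `m` is not essentially bounded). [folklore] -/
def multiplier (m : X → ℝ) : Lp ℝ 2 ν →L[ℝ] Lp ℝ 2 ν :=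
  if h : IsBddAE ν m then
    ((ContinuousLinearMap.mul ℝ ℝ).holderL ν 2 ∞ 2).flip
      ((memLp_top_of_bound h.1 h.2.choose h.2.choose_spec).toLp m)
  else 0

/-- `multiplier ν m g = m · g` almost everywhere when `m` is essentially bounded. [folklore] -/
theorem coeFn_multiplier {m : X → ℝ} (h : IsBddAE ν m) (g : Lp ℝ 2 ν) :
    multiplier ν m g =ᵐ[ν] fun x => m x * g x := by
  unfold multiplier
  rw [dif_pos h]
  simp only [ContinuousLinearMap.flip_apply, ContinuousLinearMap.holderL_apply_apply]
  filter_upwards [(ContinuousLinearMap.mul ℝ ℝ).coeFn_holder (r := 2) g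
      ((memLp_top_of_bound h.1 h.2.choose h.2.choose_spec).toLp m),
    (memLp_top_of_bound h.1 h.2.choose h.2.choose_spec).coeFn_toLp] with x hx hm
  rw [hx, ContinuousLinearMap.mul_apply', hm, mul_comm]

end Multiplier

/-- For `ω₂, ε > 0` the square root of the collision weight is a bounded continuous weight, so
`multiplier` is the honest multiplication operator. [folklore] -/
theorem isBddAE_sqrt_collisionWeight {ω₂ lam β ε : ℝ} (hω : 0 < ω₂) (hε : 0 < ε) :
    IsBddAE μ𝕋3 (fun k => Real.sqrt (collisionWeight ω₂ lam β ε k)) := by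
  refine ⟨((continuous_collisionWeight ω₂ lam β hω hε).sqrt).aestronglyMeasurable, ?_⟩
  refine ⟨Real.sqrt (9 * Real.pi / 16 * (|lam| + 16 * |β|) ^ 2 * (ω₂ ^ 2)⁻¹ ^ 2 *
    (1 / (Real.pi * ε))), ae_of_all _ fun k => ?_⟩
  rw [Real.norm_eq_abs, abs_of_nonneg (Real.sqrt_nonneg _)]
  exact Real.sqrt_le_sqrt (collisionWeight_le hω hε k)

/-- The dispersion is a bounded continuous weight on `𝕋`. [folklore] -/
theorem isBddAE_dispersion (ω₂ : ℝ) : IsBddAE μ𝕋 (dispersion ω₂) :=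
  ⟨(continuous_dispersion ω₂).aestronglyMeasurable, Real.sqrt (|ω₂| + 4),
    ae_of_all _ fun k => by
      rw [Real.norm_eq_abs, abs_of_nonneg (dispersion_nonneg _ _)]
      exact dispersion_le ω₂ k⟩

/-! ### The regularised collision operators `L_ε`, `L̃_ε = ωL_εω` -/

/-- `T_ε f = √W_ε · (f₁ + f₂ - f₃ - f₄)`, `H → L²(𝕋3)`. [cite: LukkarinenSpohn2008, §3 eq. (3.2)] -/
def collisionAmplitudeReg (ω₂ lam β ε : ℝ) : H →L[ℝ] H₃ :=
  multiplier μ𝕋3 (fun k => Real.sqrt (collisionWeight ω₂ lam β ε k)) ∘L collisionDifference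

/-- The `ε`-REGULARISED LINEARISED PAIR-COLLISION OPERATOR `L_ε = T_ε† T_ε` of the pinned chain on
`H = L²(𝕋, dk)` (unit temperature, combined vertex); `⟪f, L_ε f⟫ = ∫ W_ε (f₁ + f₂ - f₃ - f₄)²`
(`inner_collisionOpReg_eq_integral`). ALS (3.20)/(4.1) with `δ(Ω) ↦ δ_ε(Ω)`; LS2008's `L_ε`.
[cite: LukkarinenSpohn2008, §3 eqs. (3.1)–(3.2)] -/
def collisionOpReg (ω₂ lam β ε : ℝ) : H →L[ℝ] H :=
  ContinuousLinearMap.adjoint (collisionAmplitudeReg ω₂ lam β ε) ∘L collisionAmplitudeReg ω₂ lam β ε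

/-- The MODIFIED regularised operator `L̃_ε = ω L_ε ω` (`= (T_ε M_ω)†(T_ε M_ω)`), whose semigroup
governs the current correlation: ALS's `V⁻¹LV⁻¹` with `V = ω⁻¹` at unit temperature, LS2008's
`L̃ = ωLω`. [cite: LukkarinenSpohn2008, §1 eq. (1.17)] -/
def modCollisionOpReg (ω₂ lam β ε : ℝ) : H →L[ℝ] H :=
  ContinuousLinearMap.adjoint (collisionAmplitudeReg ω₂ lam β ε ∘L multiplier μ𝕋 (dispersion ω₂)) ∘L
    (collisionAmplitudeReg ω₂ lam β ε ∘L multiplier μ𝕋 (dispersion ω₂))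

/-- `L_ε` is self-adjoint. [cite: AokiLukkarinenSpohn2006, §3 after eq. (3.20)] -/
theorem isSelfAdjoint_collisionOpReg (ω₂ lam β ε : ℝ) :
    IsSelfAdjoint (collisionOpReg ω₂ lam β ε) :=
  (ContinuousLinearMap.isPositive_adjoint_comp_self _).isSelfAdjoint

/-- `L_ε ≥ 0`. [cite: LukkarinenSpohn2008, Proposition 3.1] -/
theorem isPositive_collisionOpReg (ω₂ lam β ε : ℝ) : (collisionOpReg ω₂ lam β ε).IsPositive :=
  ContinuousLinearMap.isPositive_adjoint_comp_self _

/-- `L̃_ε` is self-adjoint. [cite: LukkarinenSpohn2008, Proposition 2.4] -/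
theorem isSelfAdjoint_modCollisionOpReg (ω₂ lam β ε : ℝ) :
    IsSelfAdjoint (modCollisionOpReg ω₂ lam β ε) :=
  (ContinuousLinearMap.isPositive_adjoint_comp_self _).isSelfAdjoint

/-- `L̃_ε ≥ 0`. [cite: LukkarinenSpohn2008, Proposition 2.4] -/
theorem isPositive_modCollisionOpReg (ω₂ lam β ε : ℝ) :
    (modCollisionOpReg ω₂ lam β ε).IsPositive :=
  ContinuousLinearMap.isPositive_adjoint_comp_self _

/-- `⟪f, L_ε f⟫ = ‖T_ε f‖²`. [folklore] -/
theorem inner_collisionOpReg_self (ω₂ lam β ε : ℝ) (f : H) :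
    ⟪f, collisionOpReg ω₂ lam β ε f⟫_ℝ = ‖collisionAmplitudeReg ω₂ lam β ε f‖ ^ 2 := by
  unfold collisionOpReg
  rw [ContinuousLinearMap.comp_apply, ContinuousLinearMap.adjoint_inner_right,
    real_inner_self_eq_norm_sq]

/-- **The regularised quadratic form is ALS (4.1) with `δ_ε`**: for `ω₂, ε > 0` and `f ∈ L²(𝕋)`,
`⟪f, L_ε f⟫ = ∫_{𝕋3} W_ε(k) (f(k₁) + f(k₂) - f(k₃) - f(k₁ + k₂ - k₃))² dk₁dk₂dk₃`.
[cite: AokiLukkarinenSpohn2006, §4 eq. (4.1)] -/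
theorem inner_collisionOpReg_eq_integral {ω₂ lam β ε : ℝ} (hω : 0 < ω₂) (hε : 0 < ε) (f : H) :
    ⟪f, collisionOpReg ω₂ lam β ε f⟫_ℝ =
      ∫ k, collisionWeight ω₂ lam β ε k * (f k.1 + f k.2.1 - f k.2.2 - f (k₄ k)) ^ 2 ∂μ𝕋3 := by
  rw [inner_collisionOpReg_self, ← real_inner_self_eq_norm_sq, L2.inner_def]
  refine integral_congr_ae ?_
  have hT : collisionAmplitudeReg ω₂ lam β ε f =ᵐ[μ𝕋3]
      fun k => Real.sqrt (collisionWeight ω₂ lam β ε k) * (f k.1 + f k.2.1 - f k.2.2 - f (k₄ k)) := by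
    unfold collisionAmplitudeReg
    rw [ContinuousLinearMap.comp_apply]
    filter_upwards [coeFn_multiplier μ𝕋3
      (isBddAE_sqrt_collisionWeight (lam := lam) (β := β) hω hε) (collisionDifference f),
      coeFn_collisionDifference f] with k hk hD
    rw [hk, hD]
  filter_upwards [hT] with k hk
  rw [hk, real_inner_self_eq_norm_sq, Real.norm_eq_abs, sq_abs, mul_pow,
    Real.sq_sqrt (collisionWeight_nonneg ω₂ lam β hε.le k)]

/-- `⟪f, L_ε f⟫ ≥ 0`. [cite: LukkarinenSpohn2008, Proposition 3.1] -/
theorem inner_collisionOpReg_self_nonneg (ω₂ lam β ε : ℝ) (f : H) :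
    0 ≤ ⟪f, collisionOpReg ω₂ lam β ε f⟫_ℝ := by
  rw [inner_collisionOpReg_self]; positivity

/-! ### From functions to `L²` classes -/

open Classical in
/-- The `L²(𝕋)` class of a function on the circle (junk value `0` if it is not in `L²`).
[folklore] -/
def toL2 (f : 𝕋 → ℝ) : H := if h : MemLp f 2 μ𝕋 then h.toLp f else 0

/-- `toL2 f` is the class of `f` when `f ∈ L²`. [folklore] -/
theorem toL2_eq {f : 𝕋 → ℝ} (h : MemLp f 2 μ𝕋) : toL2 f = h.toLp f := by
  unfold toL2; rw [dif_pos h]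

/-- `toL2 f = f` almost everywhere when `f ∈ L²`. [folklore] -/
theorem coeFn_toL2 {f : 𝕋 → ℝ} (h : MemLp f 2 μ𝕋) : toL2 f =ᵐ[μ𝕋] f := by
  rw [toL2_eq h]; exact h.coeFn_toLp

/-- Continuous functions on the (compact) circle are in `L²`. [folklore] -/
theorem memLp_two_of_continuous {f : 𝕋 → ℝ} (hf : Continuous f) : MemLp f 2 μ𝕋 := by
  obtain ⟨C, hC⟩ := isCompact_univ.exists_bound_of_continuousOn hf.continuousOn
  exact (memLp_top_of_bound hf.aestronglyMeasurable C
    (ae_of_all _ fun x => hC x (mem_univ x))).mono_exponent le_top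

/-- `2π`-periodic functions on `ℝ` as functions on `𝕋` (restriction to `(-π, π]`). [folklore] -/
def periodize (f : ℝ → ℝ) : 𝕋 → ℝ := AddCircle.liftIoc (2 * Real.pi) (-Real.pi) f

/-- `periodize f ↑x = f x` on the cell `(-π, π]`. [folklore] -/
theorem periodize_coe_apply {f : ℝ → ℝ} {x : ℝ}
    (hx : x ∈ Ioc (-Real.pi) (-Real.pi + 2 * Real.pi)) : periodize f (x : 𝕋) = f x :=
  AddCircle.liftIoc_coe_apply hx

/-- The current weight as an element `ṽ ∈ H`. [cite: AokiLukkarinenSpohn2006, §3 eq. (3.21)] -/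
def currentWeightL2 (ω₂ : ℝ) : H := toL2 (currentWeight ω₂)

/-- `ṽ ∈ H` is the class of `sin/ω` for `ω₂ > 0`. [folklore] -/
theorem coeFn_currentWeightL2 {ω₂ : ℝ} (hω : 0 < ω₂) :
    currentWeightL2 ω₂ =ᵐ[μ𝕋] currentWeight ω₂ :=
  coeFn_toL2 (memLp_two_of_continuous (continuous_currentWeight hω))

/-! ### Regularised quadratic form, kinetic profile, and their `ε → 0⁺` limits -/

/-- The regularised collision quadratic form `Q_ε(f) = ⟪f, L_ε f⟫` of an `L²` class.
[cite: LukkarinenSpohn2008, §3 eq. (3.2)] -/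
def collisionFormReg (ω₂ lam β ε : ℝ) (f : H) : ℝ := ⟪f, collisionOpReg ω₂ lam β ε f⟫_ℝ

/-- The regularised KINETIC PROFILE `K_ε(τ) = ⟪ṽ, exp(-τ L̃_ε) ṽ⟫` (semigroup of the bounded
self-adjoint `L̃_ε ≥ 0` applied to the current weight).
[cite: AokiLukkarinenSpohn2006, §3 eq. (3.21)] -/
def kineticProfileReg (ω₂ lam β ε τ : ℝ) : ℝ :=
  ⟪currentWeightL2 ω₂,
    NormedSpace.exp (-(τ • modCollisionOpReg ω₂ lam β ε)) (currentWeightL2 ω₂)⟫_ℝ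

/-- `K_ε(0) = ‖ṽ‖²`. [folklore] -/
theorem kineticProfileReg_zero (ω₂ lam β ε : ℝ) :
    kineticProfileReg ω₂ lam β ε 0 = ‖currentWeightL2 ω₂‖ ^ 2 := by
  unfold kineticProfileReg
  rw [zero_smul, neg_zero, NormedSpace.exp_zero, one_apply_eq_self, real_inner_self_eq_norm_sq]

end PinnedChainKinetic

open PinnedChainKinetic

/-- **The linearised phonon Boltzmann pair-collision operator of the pinned chain**
`pinnedChain ω₂ lam β γ` at unit temperature, in its `ε`-regularised form `L_ε = T_ε†T_ε` on
`H = L²(ℝ/2πℤ, dk)` (`ε > 0` the width of `δ_ε(Ω)`; bounded, self-adjoint, `≥ 0`, with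
`⟪f, L_ε f⟫ = (9π/16)∫ v²(ω₁ω₂ω₃ω₄)⁻²δ_ε(Ω)(f₁ + f₂ - f₃ - f₄)² dk₁dk₂dk₃`). Following LS2008 §3 the
collision operator PROPER is the `ε → 0⁺` limit of this family (in the quadratic-form sense:
`pinnedChainCollisionForm`; semigroup matrix element: `pinnedChainKineticProfile`); for `β = 0`
and `δ ↦ δ_ε` this is ALS's `L` of (3.20)/(4.1), for `lam = 0` the pinned analogue of LS2008 (1.16).
[cite: AokiLukkarinenSpohn2006, §3 eq. (3.20) and §4 eq. (4.1)] -/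
abbrev pinnedChainCollisionOperator (ω₂ lam β ε : ℝ) : H →L[ℝ] H := collisionOpReg ω₂ lam β ε

/-- **The linearised pair-collision quadratic form of the pinned chain** `⟨f, L f⟩` for a
`2π`-periodic `f : ℝ → ℝ` (unit temperature, combined vertex `lam + β·B`), DEFINED as the
`ε → 0⁺` limit of the regularised forms `⟪f, L_ε f⟫ = ∫ W_ε (f₁ + f₂ - f₃ - f₄)²`
(junk value if the limit does not exist; LS2008 Prop. 3.1 proves existence for Lipschitz `f`
on the FPU band, the pinned-band analogue being ALS (4.11)).
[cite: AokiLukkarinenSpohn2006, §4 eqs. (4.1), (4.11)] -/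
def pinnedChainCollisionForm (ω₂ lam β : ℝ) (f : ℝ → ℝ) : ℝ :=
  limUnder (𝓝[>] (0 : ℝ)) fun ε => collisionFormReg ω₂ lam β ε (toL2 (periodize f))

/-- **The kinetic profile of the pinned chain** `K(τ) = ⟨ṽ, e^{-τL̃} ṽ⟩`, DEFINED as the `ε → 0⁺`
limit of `K_ε(τ) = ⟪ṽ, exp(-τL̃_ε)ṽ⟫` (junk value if the limit does not exist). Kinetic theory
predicts `K(τ) = lim_{T→0⁺} T⁻² C_T(τT⁻²)` for the current correlation `C_T` of
`pinnedChain ω₂ lam β γ` (ALS (3.21) transported by the amplitude-scaling conjugacy).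
[cite: AokiLukkarinenSpohn2006, §3 eq. (3.21)] -/
def pinnedChainKineticProfile (ω₂ lam β : ℝ) (τ : ℝ) : ℝ :=
  limUnder (𝓝[>] (0 : ℝ)) fun ε => kineticProfileReg ω₂ lam β ε τ

/-- **The kinetic constant** `c = ∫₀^∞ K(τ) dτ` (`= ⟨ṽ, L̃⁻¹ṽ⟩` when `K` is the semigroup profile
of `L̃ ≥ 0` with `ṽ ⊥ ker L̃`), the predicted `lim_{T→0⁺} T²κ_GK(T)` of `pinnedChain ω₂ lam β γ`
(ALS (3.22)–(3.23): `κ ≅ c·T⁻²`; for `β = 0`, `c = δ^{-5/2}⟨ω⁻²g, L⁻¹ω⁻²g⟩` in ALS's units).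
[cite: AokiLukkarinenSpohn2006, §3 eqs. (3.22)–(3.23)] -/
def pinnedChainKineticConstant (ω₂ lam β : ℝ) : ℝ :=
  ∫ τ in Ioi (0 : ℝ), pinnedChainKineticProfile ω₂ lam β τ

end Literature.MathematicalPhysics.KineticTheory.HeatConduction
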